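import Literature.AnabelianGeometry.EtaleTheta.TemperedFrobenioidOfGaloisCoveringOneComponentWeak
import Literature.AnabelianGeometry.EtaleTheta.Discharge.Sec3Prop34iiOfGaloisCovering
import Literature.AnabelianGeometry.EtaleTheta.DivisorMonoidsConstants34
import HarnessLib

/-!
# [EtTh] Prop. 3.4 (ii), third isomorphism (`Prop34Const`), PROVED at the constructed Def. 3.3 (iii) data of the
# one-component model (the last residual of the cell's Cor. 3.8 closers at that NON-DEGENERATE constructed tempered Frobenioid)

S. Mochizuki, *The étale theta function and its Frobenioid-theoretic manifestations*, Publ. RIMS **45** (2009),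
Prop. 3.4 (ii) PDF p. 74 ("`L^× ⥲ F₀(Y^log)`", "`div₀(c) = v_L(c)·div(ϖ_L)`"), Def. 3.1 (i)/(ii) p. 70, Def. 3.3 (iii) p. 73,
Cor. 3.8 pp. 80–82 [cite: MochizukiEtTh2009, Prop 3.4 (ii) p.74]; [FrdII] Ex. 1.1 (the `p`-adic Frobenioid).

abc-iut cell, layer L2, seat abc-iut-L2-d2 (gen 5), row «COR38(i)(ii)@TateTower» companion.  PROOF-ONLY (0 definitions).
abc-iut-L2-t3's binder of record `DivisorMonoids.Prop34Const` (GAP-LEDGER G-L2d2-3; p434595) is the LAST residual input of the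
cell's Cor. 3.8 (iii) closers at the constructed connected data (abc-iut-w6-d052's `cor38_iii_ofRankOnePoint`, p447266:
"residual = `Prop34Const` ONLY").  THIS FILE proves it for abc-iut-w6-d048's ONE-COMPONENT model (`LogDivisorModel.oneComp U
hU`: a proper curve with SMOOTH reduction — one special-fibre component `F`, no cusps, `Z_∞ = X`, `Gal = 1`,
`Mero(Z_∞) = L^× = O_L^× · ϖ^ℤ = U × ℤ`) over abc-iut-w6-d058's Def. 3.3 (iii) data of its connected coverings
`OneCompFrd.dm U hU = ofGaloisActionConnected (act U hU) (cuspLaws_oneComp U hU)`: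

* `OneCompFrd.prop34Const_dm : (OneCompFrd.dm U hU).Prop34Const` — (a) `F₀(Y) = Hom_1(Y, L^×)` is a group
  (abc-iut-w6-d058's `GaloisAction.exists_inv_mem_fZero`); (b) at every connected covering `Y` (a one-point `1`-set):
  `d_Y := [F]` (`constPhi … 1`) is non-cuspidal (`nonCuspidal = ⊤`), nonzero, `= div₀(ϖ)` for the constant `ϖ = (1, 1)`,
  and every constant `c = (u, n)` has `div₀(c) = n·[F] = d_Y^n` (`c = (c·ϖ^{-n})·ϖ^n` in the group `B₀(Y)`,
  `div₀(c·ϖ^{-n}) = 0`, `map_zpow`).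
* CONSEQUENCE (sequel file, once abc-iut-w6-d052's rank-one-point (iii) knit p447266 is in the tree): [EtTh] Cor. 3.8 (i) ∧ (ii) ∧
  (iii) AS TYPED with NO binder at abc-iut-w6-d048's one-component weak witness `OneCompFrd.temperedFrobenioidWeak` — (i)/(ii) are
  already unconditional there (this seat's `OneCompFrd.cor38_i/ii_temperedFrobenioidWeak`), (iii)'s only residual is the
  `Prop34Const` proved here.

HONEST LABEL: an instantiation / consistency certificate over GENUINE vocabularies and CONSTRUCTED data (one component, no
cusps; `D` one object); `Prop34Const` is a property of the genuine geometric data, here VERIFIED for this model, never asserted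
for abstract data; refereed pre-IUT material; nothing here bears on [IUTchIII] Cor. 3.12; no side taken; typed ≠ proved.
-/

noncomputable section

namespace Literature.AnabelianGeometry.EtaleTheta

open CategoryTheory Opposite Function Literature.AlgebraicGeometry.Frobenioids
  Literature.AnabelianGeometry.SemiGraphs LogDivisorModel LogDivisorModel.GaloisAction

namespace OneCompFrd

variable (U : Type) [CommGroup U] (hU : ∀ u : U, (∀ N : ℕ+, ∃ g : U, g ^ (N : ℕ) = u) → u = 1)

/-! ### `div₀` of the constants `u·ϖⁿ` at every connected covering -/

/-- The generator `[F] ∈ Φ₀(Y)` is nonzero at every connected covering `Y`. [cite: MochizukiEtTh2009, Def 3.3 p.73] -/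
theorem constPhi_one_ne_one (S : D₀) : constPhi U hU S 1 ≠ 1 := fun h => by
  have hs := congrArg (fun φ : (act U hU).phiZero S.obj => Multiplicative.toAdd (φ.1 S.property.1.some)) h
  change Multiplicative.toAdd (Multiplicative.ofAdd ((1 : ℕ) : ℤ)) = Multiplicative.toAdd (1 : Multiplicative ℤ) at hs
  rw [toAdd_ofAdd, toAdd_one] at hs
  exact one_ne_zero hs

/-- `n·[F] = [F]^n` in `Φ₀(Y)`. [cite: MochizukiEtTh2009, Def 3.3 p.73] -/
theorem constPhi_eq_pow (S : D₀) (n : ℕ) : constPhi U hU S n = constPhi U hU S 1 ^ n := by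
  refine Subtype.ext (funext fun s => ?_)
  change (Multiplicative.ofAdd (n : ℤ) : Multiplicative ℤ) = ((constPhi U hU S 1 ^ n).1) s
  rw [SubmonoidClass.coe_pow, Pi.pow_apply]
  change (Multiplicative.ofAdd (n : ℤ) : Multiplicative ℤ) = Multiplicative.ofAdd ((1 : ℕ) : ℤ) ^ n
  rw [← ofAdd_nsmul, nsmul_eq_mul, Nat.cast_one, mul_one]

/-- **`div₀` of a constant with trivial valuation is trivial** (`div₀(u) = 0` for `u ∈ O_L^×`): for `b ∈ B₀(Y)` whose values
have valuation `0` (stated for abc-iut-w6-d058's `divZeroHom`, which IS `div₀` of the data, `rfl`).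
[cite: MochizukiEtTh2009, Prop 3.4 (ii) p.74] -/
theorem divZeroHom_eq_one_of_val_eq_zero (S : D₀) (b : (act U hU).bZero S.obj)
    (hb : ∀ s, Multiplicative.toAdd (b.1 s).2 = 0) : (act U hU).divZeroHom S.obj b = 1 := by
  have h := ((act U hU).divZeroHom_eq_div_iff S.obj b 1 1).2 fun s => by
    change (b.1 s).2 * 1 = 1
    rw [mul_one]
    exact toAdd_eq_zero.mp (hb s)
  rw [map_one, div_one] at h
  exact h

/-- **`div₀(ϖ) = [F]`** at every connected covering `Y`, for the constant `ϖ := (1, 1) ∈ L^× = U × ℤ`.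
[cite: MochizukiEtTh2009, Prop 3.4 (ii) p.74] -/
theorem divZeroHom_varpi (S : D₀) :
    (act U hU).divZeroHom S.obj ⟨fun _ => ((1 : U), Multiplicative.ofAdd (1 : ℤ)), fun _ => trivial, fun _ _ => rfl⟩ =
      Algebra.GrothendieckGroup.of (constPhi U hU S 1) :=
  (((act U hU).divZeroHom_eq_div_iff _ _ (constPhi U hU S 1) 1).2 fun _ => mul_one _).trans (by rw [map_one, div_one])

/-- **"`div₀(c) = v_L(c)·div(ϖ_L)`" at every connected covering**: every `b ∈ B₀(Y) = Hom_1(Y, L^×)` (all functions of the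
one-component model are constant) has `div₀(b) = [F]^{v(b)}`, `v(b) ∈ ℤ` the valuation of its value at the point — `b =
(b·ϖ^{-v})·ϖ^{v}` in the group `B₀(Y)` with `div₀(b·ϖ^{-v}) = 0`. [cite: MochizukiEtTh2009, Prop 3.4 (ii) p.74] -/
theorem divZeroHom_eq_zpow (S : D₀) (b : (act U hU).bZero S.obj) :
    ∃ n : ℤ, (act U hU).divZeroHom S.obj b = Algebra.GrothendieckGroup.of (constPhi U hU S 1) ^ n := by
  let s₀ : S.obj.V := S.property.1.some
  let n : ℤ := Multiplicative.toAdd (b.1 s₀).2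
  let ϖ : (act U hU).bZero S.obj :=
    ⟨fun _ => ((1 : U), Multiplicative.ofAdd (1 : ℤ)), fun _ => trivial, fun _ _ => rfl⟩
  refine ⟨n, ?_⟩
  have hu : (act U hU).divZeroHom S.obj (b * ϖ ^ (-n)) = 1 := by
    refine divZeroHom_eq_one_of_val_eq_zero U hU S _ fun s => ?_
    have hs : s = s₀ := eq_of_isConnectedGSet_punit S.property s s₀
    rw [Subgroup.coe_mul, SubgroupClass.coe_zpow, Pi.mul_apply, Pi.pow_apply]
    change Multiplicative.toAdd ((b.1 s).2 * (Multiplicative.ofAdd (1 : ℤ)) ^ (-n)) = 0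
    rw [toAdd_mul, toAdd_zpow, toAdd_ofAdd, smul_eq_mul, mul_one, hs]
    exact add_neg_cancel _
  have hb : b = b * ϖ ^ (-n) * ϖ ^ n := by rw [mul_assoc, ← zpow_add, neg_add_cancel, zpow_zero, mul_one]
  rw [hb, map_mul, hu, one_mul, map_zpow, divZeroHom_varpi]

/-! ### `Prop34Const` at the one-component data, and Cor. 3.8 (i) ∧ (ii) ∧ (iii) with no binder -/

/-- **abc-iut-L2-t3's [EtTh] Prop. 3.4 (ii) third-isomorphism bundle `DivisorMonoids.Prop34Const` (GAP-LEDGER G-L2d2-3) HOLDS at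
the constructed Def. 3.3 (iii) data of the one-component model**: (a) `F₀(Y)` is a group (abc-iut-w6-d058's
`exists_inv_mem_fZero`); (b) `d_Y := [F]` is non-cuspidal (no cusps: `nonCuspidal = ⊤`), nonzero, the divisor of the constant
`ϖ = (1, 1) ∈ F₀(Y)`, and every constant has divisor `d_Y^{v}`. [cite: MochizukiEtTh2009, Prop 3.4 (ii) p.74] -/
theorem prop34Const_dm : (dm U hU).Prop34Const where
  inv_mem_F₀ Y b hb := (act U hU).exists_inv_mem_fZero Y.unop.obj b hb
  exists_specialFibre Y :=
    ⟨constPhi U hU Y.unop 1, fun _ => trivial, constPhi_one_ne_one U hU Y.unop,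
      ⟨⟨fun _ => ((1 : U), Multiplicative.ofAdd (1 : ℤ)), fun _ => trivial, fun _ _ => rfl⟩, fun _ => trivial,
        divZeroHom_varpi U hU Y.unop⟩,
      fun b _ => divZeroHom_eq_zpow U hU Y.unop b⟩

end OneCompFrd

end Literature.AnabelianGeometry.EtaleTheta

end
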